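import Summits.ResolutionOfSingularities.ResolutionOfSingularities.Theorems.RadicialJungCleanModelsStubFrobeniusStalkFiniteFlat
import Summits.ResolutionOfSingularities.ResolutionOfSingularities.Theorems.RadicialJungCleanModelsReduction
import Literature.AlgebraicGeometry.Motives.RatFnBirational
import Literature.AlgebraicGeometry.Resolution.AlterationsDimension
import HarnessLib

/-!
# The affine chart of the dimension-2 `F`-finite cut of crux `CleanModels` (line `Sketch` rev 10)

Route `ResolutionOfSingularities/RadicialJung`, crux item `CleanModels`
(stmt-ResolutionOfSingularities-15917), line `Sketch` rev 10 (lead c2), stub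
`stub_principalizationDimTwoFFinite`. Giraud's theorem (`Giraud1983Thm24`, Giraud 1983 Thm. 2.4) is
applied to a non-empty AFFINE open subscheme `X = ↑D'` of the current regular model `V` (of finite
type over the `F`-finite field `k`); this file verifies Giraud's hypotheses for such an `X` and
records the bookkeeping of rational functions of sections:

* `isIntegral_chart`, `compactSpace_chart`, `charP_sections_chart`, `isRegular_chart`,
  `topologicalKrullDim_chart`, `frobenius_chart` — `X` is integral, quasi-compact, of
  characteristic `p` (on sections and stalks), regular, of the dimension of `V`, with finite and
  flat Frobenius on its local rings (`stub_frobeniusStalkFiniteFlat`, transported along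
  `Scheme.Opens.stalkIso`);
* `toFunctionField_germ_transport` — the rational function of a section transported along an
  equality of opens;
* `ne_pow_of_functionFieldMap_bijective` — "not a `p`-th power" is transported along a bijective
  map of function fields.
-/

noncomputable section

set_option linter.dupNamespace false -- mandated namespace of this single-conjunct summit

open CategoryTheory AlgebraicGeometry TopologicalSpace IsLocalRing
open Literature.AlgebraicGeometry.Resolution Literature.AlgebraicGeometry.Motives

namespace Summit.ResolutionOfSingularities.ResolutionOfSingularities.Theorems.RadicialJung.CleanModels

universe u

/-! ## Giraud's hypotheses on a non-empty affine open subscheme -/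

section Chart

variable {V : Scheme.{0}} (D' : V.Opens)

/-- A non-empty open subscheme of an integral scheme is integral. [folklore] -/
theorem isIntegral_chart [IsIntegral V] (hne : (D' : Set V).Nonempty) :
    IsIntegral (D' : Scheme.{0}) := by
  haveI : Nonempty (D' : Scheme.{0}) := ⟨⟨_, hne.some_mem⟩⟩
  exact isIntegral_of_isOpenImmersion D'.ι

/-- An affine open subscheme is quasi-compact. [folklore] -/
theorem compactSpace_chart (hD' : IsAffineOpen D') : CompactSpace (D' : Scheme.{0}) := by
  haveI : IsAffine (D' : Scheme.{0}) := hD'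
  infer_instance

/-- The sections of a non-empty open subscheme of an integral scheme over a field of
characteristic `p` have characteristic `p`. [folklore] -/
theorem charP_sections_chart (p : ℕ) {k : Type} [Field k] [CharP k p] [IsIntegral V]
    (q : V ⟶ Spec (.of k)) (hne : (D' : Set V).Nonempty) : CharP Γ((D' : Scheme.{0}), ⊤) p := by
  haveI := isIntegral_chart D' hne
  -- `k → Γ(Spec k, ⊤) → Γ(↑D', ⊤)` is injective (a ring map out of a field into a domain)
  let φ : k →+* Γ((D' : Scheme.{0}), ⊤) :=
    ((D'.ι ≫ q).appTop).hom.comp (Scheme.ΓSpecIso (.of k)).inv.hom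
  exact charP_of_injective_ringHom φ.injective p

/-- An open subscheme of a regular scheme is regular. [folklore] -/
theorem isRegular_chart (hV : Scheme.IsRegular V) : Scheme.IsRegular (D' : Scheme.{0}) := fun x =>
  haveI := hV x.1
  IsRegularLocalRing.of_ringEquiv (D'.stalkIso x).symm.commRingCatIsoToRingEquiv

/-- A non-empty open subscheme of an integral scheme locally of finite type over a field has the
same dimension. [folklore] -/
theorem topologicalKrullDim_chart {k : Type} [Field k] [IsIntegral V] (q : V ⟶ Spec (.of k))
    [LocallyOfFiniteType q] (hne : (D' : Set V).Nonempty) :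
    topologicalKrullDim (D' : Scheme.{0}) = topologicalKrullDim V :=
  topologicalKrullDim_opens_eq q D' hne

end Chart

/-- Frobenius commutes with ring isomorphisms: `F_B = e ∘ F_A ∘ e⁻¹`. [folklore] -/
theorem frobenius_eq_conj {A B : Type*} [CommRing A] [CommRing B] (p : ℕ) [ExpChar A p]
    [ExpChar B p] (e : A ≃+* B) :
    frobenius B p = (e.toRingHom.comp (frobenius A p)).comp e.symm.toRingHom := by
  ext b
  simp [frobenius_def]

/-- **Frobenius is finite and flat on the local rings of an open subscheme** of a regular scheme
locally of finite type over an `F`-finite field (`stub_frobeniusStalkFiniteFlat` transported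
along `Scheme.Opens.stalkIso`). [folklore] -/
theorem frobenius_chart {V : Scheme.{0}} (D' : V.Opens) (p : ℕ) [Fact p.Prime] (k : Type) [Field k]
    [CharP k p] (hk : IsFFinite p 1 k) (q : V ⟶ Spec (.of k)) [LocallyOfFiniteType q]
    (hV : Scheme.IsRegular V) (x : (D' : Scheme.{0})) [CharP ((D' : Scheme.{0}).presheaf.stalk x) p] :
    (frobenius ((D' : Scheme.{0}).presheaf.stalk x) p).Finite ∧
      (frobenius ((D' : Scheme.{0}).presheaf.stalk x) p).Flat := by
  haveI : CharP (V.presheaf.stalk x.1) p := charP_stalk V q x.1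
  obtain ⟨hfin, hflat⟩ := stub_frobeniusStalkFiniteFlat p k hk V q hV x.1
  let e : V.presheaf.stalk x.1 ≃+* (D' : Scheme.{0}).presheaf.stalk x :=
    (D'.stalkIso x).symm.commRingCatIsoToRingEquiv
  rw [frobenius_eq_conj p e]
  exact ⟨((RingHom.Finite.of_surjective _ e.surjective).comp hfin).comp
      (RingHom.Finite.of_surjective _ e.symm.surjective),
    (RingHom.Flat.of_bijective e.symm.bijective).comp
      (hflat.comp (RingHom.Flat.of_bijective e.bijective))⟩

/-! ## Rational functions of sections -/

/-- The rational function of a section read at a point does not change when the section is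
transported along an equality of opens. [folklore] -/
theorem toFunctionField_germ_transport {X : Scheme.{u}} [IsIntegral X] {U U' : X.Opens}
    (h : U = U') (x : X) (hx : x ∈ U) (hx' : x ∈ U') (s : Γ(X, U)) :
    RatFn.toFunctionField x (X.presheaf.germ U' x hx' (X.presheaf.map (eqToHom h.symm).op s)) =
      RatFn.toFunctionField x (X.presheaf.germ U x hx s) := by
  subst h
  simp

/-- "Not a `p`-th power" is transported along a bijective ring map. [folklore] -/
theorem ne_pow_of_bijective {K K' : Type*} [CommRing K] [CommRing K'] (F : K →+* K')
    (hF : Function.Bijective F) (p : ℕ) {g : K} (hg : ∀ c : K, c ^ p ≠ g) (c : K') :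
    c ^ p ≠ F g := by
  obtain ⟨c', rfl⟩ := hF.2 c
  rw [← map_pow]
  exact fun h => hg c' (hF.1 h)

end Summit.ResolutionOfSingularities.ResolutionOfSingularities.Theorems.RadicialJung.CleanModels

end
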